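/-
Copyright (c) 2026 the pub-hodgecm-mathlib formalisation cell (harness21).  Prover seat hodgecm-mathlib-LH10-p01 (g11), 2026-09-03.  Road M6 «ROW 2 ★ DYADIC TWIN» → F5 HEAD
(LEAD F0P3a-plan T15-32 GO-LOW; F3-5∕F5 pen LH7-p04 (g12) OFFER 02:16:08Z «(B2b)+(B2c)», SIG-F5-END v1 af0d605b §2; CONSUMER SPEC 02:22:26Z), brick (B2b-I) «CLASS TOTAL = PLACE COUNT».
-/
import Literature.NumberTheory.Rogawski1990.DepthZeroKappaTransferTypeTwoUnitRow            -- ★ T3′ P-2 (F0P3b-p01): `exists_haar_normalised_isCanonical`, `tsupport_indicator_cmLocalIntegralLevel_subset`, `indicator_cmLocalIntegralLevel_conj`, the strata currency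
import Literature.NumberTheory.Rogawski1990.UnitFundamentalLemmaInertIrredValuePos          -- ★ B-p12 p842319: the (α) transport idiom (frame `e`, ★ `localNonsplitCongr`, ★ `natCard_fixedBy_cmLocalIntegralLevel_eq_of_frame`, …) and its imports
import Literature.NumberTheory.Automorphic.UnitaryTypeTwoNormPairCentralizerCompactRamified -- ★ `compactSpace_centralizer_of_isLocalNormPair_of_not_exists_isRoot_nonsplit` (2-free compact centraliser)
import Literature.NumberTheory.Automorphic.UnitaryFixedCosetsStableLattices                  -- ★ (B2a) (LH7-p04 (g12)) p853288: `natCard_fixedCosets_unitaryInt_eq_ncard_isSelfDualLattice_stable`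
import Literature.NumberTheory.Automorphic.UnitaryLatticeTreeSelfDualTransitiveOfTrace       -- ★ `exists_unitary_mapGL_stdLattice_eq_of_isSelfDualLattice_of_trace` (2-free transitivity on self-dual vertices)
import Literature.NumberTheory.Automorphic.UnitaryLatticeTreeStarOfInvolution                -- ★ `isSelfDualLattice_stdLattice_three_of_v` (the root is self-dual for `J₀`)
import Literature.NumberTheory.Automorphic.UnitaryGroupInertPlaceHyperbolicBasisDyadic       -- ★ `exists_add_map_eq_one_integer` (the trace element at every unramified non-split place), `galAdicCompletionMap_mem_integer`
import Literature.NumberTheory.Automorphic.ValuedFieldValuativeRelBridge                     -- ★ `valuedInteger_eq_integer`, `v_le_one_iff_mem_integer` (the `Valued` ↔ `ValuativeRel` bridge)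
import Literature.NumberTheory.Automorphic.DeepElementCyclicLatticeStable                    -- ★ `charpoly_coeff_mem_integer_of_deep`
import HarnessLib

/-!
# The type-(2) class total is a PLACE COUNT of self-dual stable lattices (2-free): `n₀(δ) + n₁(δ) + n₂(δ) = #{M self-dual for J₀ | (Tδ_wT⁻¹)·M ⊆ M}`

Topic `NumberTheory/Rogawski1990`; namespace `Literature.NumberTheory.Rogawski1990`.  THEOREMS ONLY (no definition, no instance, no notation, no named fact, no `sorry`); kernel lane
`--supports stmt-HodgeConjecture-24833`.  Cell `pub/hodgecm-mathlib` (D-0151), crux H413 = `stmt-HodgeConjecture-24833`; road M6 → the 2-free F5 HEAD (SIG-F5-END v1 (LH7-p04 (g12))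
§2 (B2b) «2-FREE CLASS TOTALS»; (B3)'s `hK` = tame ★ `DepthZeroKappaTransferTypeTwoUnitRow.sum_ncard_rankStrata_sub_eq_neg_pow_mul_phiHtwo` with `h2 hN` struck).  The tame class totals
(★ `…UnitRow` :125∕:196) get their VALUE from ★ B-p12 `classOrbitalIntegral_indicator_eq_phiTHn_of_finKappaAt_eq_one`, whose only tame step is (β)+(γ) (`h2`, `y·σy = −2`, `hN`).
THIS FILE is step (B2b-I): everything BEFORE the value, 2-free — for a deep match `δ` of a `G`-regular type-(2) `γ_H` (`χ_{g_w}` rootless) at an inert-UNRAMIFIED `v` of ANY residue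
characteristic, and ANY frame `T ∈ GL₃(𝒪_w)` with `H′_w = ᵗ(σ_wT)·J₀·T` (`J₀ = antidiag(1,1,1)`), the three Jordan-strata counts of the fixed hyperspecial vertices of `δ` add up to
**the number of `J₀`-self-dual `𝒪_w`-lattices `M ⊆ L_w³` with `(T·δ_w·T⁻¹)·M ⊆ M`** — the LEFT side of ★ (B2a) after ★ B-p12's transport (α), i.e. EXACTLY the count that
★ γ ∕ F5-(0) evaluate (`phiTHn ∕ phiTHprimen` by class).  So (B2b-II) = this + F5-(0) + the κ-reading, and (B3)'s `hK` follows by ★ `flicker_theorem18n`.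
HONEST LABEL: HC_CM is proved only modulo the 7 printed citations (2 remaining named inputs: hLiu418 = stmt-HodgeConjecture-24832, h413 = stmt-HodgeConjecture-24833) until rung 0
closes; assembly over ★ material, asserts nothing printed, count-neutral (zero label movement until F5 ★ + a desk-priced rider).

THE MATHEMATICS.  (1) Measure-free statement: a normalised Haar measure `ν_G(K_v) = 1` with a canonical family exists on the Borel σ-algebras (★ `exists_haar_normalised_isCanonical`);
`Z(δ)` is compact (★ `…_nonsplit`, any residue characteristic).  (2) ★ A-p12's strata formula at the constant piece `1_{K_v}`, `c ≡ 1`: `Φ(⟦δ⟧, 1_{K_v}) = n₀ + n₁ + n₂`.  (3) ★ (α):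
`Φ(⟦δ⟧, 1_{K_v}) = #Fix_δ(G′_v ⧸ K_v)` (★ `classOrbitalIntegral_indicator_complex_cmLocalIntegralLevel_eq_natCard_fixedBy`) `= #Fix_{eδ}(U(J₀)(L_w) ⧸ U(J₀)(𝒪_w))` along the frame
`e = localNonsplitEquiv ∘ localNonsplitCongr_T` (★ `natCard_fixedBy_cmLocalIntegralLevel_eq_of_frame`, `(eδ)_w = T·δ_w·T⁻¹`).  (4) ★ (B2a): `= #{M self-dual for J₀ | (eδ)·M ⊆ M}`, its
three inputs at `J₀` being 2-FREE: the root is self-dual (★ `isSelfDualLattice_stdLattice_three_of_v`), `U(J₀)` is transitive on self-dual vertices given a trace element `t + σt = 1`,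
`|t| ≤ 1` (★ `…_of_trace`), which exists at every unramified non-split place (★ `exists_add_map_eq_one_integer`), and `χ_{eδ} = χ_{δ_w}` is integral (`δ` deep, ★
`charpoly_coeff_mem_integer_of_deep`).  [cite: Rogawski1990, §4.9 p. 54, Prop. 4.9.1 (b) p. 55] [cite: Kottwitz1986BaseChangeUnits, §3] [cite: Flicker1998UnitaryFL, §3 Prop. 5 p. 82; Thm. 18 p. 97]

* **`sum_ncard_rankStrata_eq_ncard_isSelfDualLattice_stable_of_frame`** (B2b-I).

## References
* [Rogawski1990] J. D. Rogawski, *Automorphic Representations of Unitary Groups in Three Variables* (1990): §4.9 p. 54 (orbital integrals of `1_K` as fixed-vertex counts), Prop. 4.9.1 (b) p. 55.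
* [Kottwitz1986BaseChangeUnits] R. E. Kottwitz, *Base change for unit elements of Hecke algebras*, Compositio Math. 60 (1986): §3 (fixed cosets `Fix_γ(G∕K)` and self-dual lattices).
* [Flicker1998UnitaryFL] Y. Z. Flicker, *Elementary proof of the fundamental lemma for a unitary group*, Canad. J. Math. 50 (1998): §3 Prop. 5 p. 82, Thm. 18 p. 97.
-/

set_option autoImplicit false

noncomputable section

open MeasureTheory Measure NumberField IsDedekindDomain Matrix Polynomial
open scoped MatrixGroups WithZero ValuativeRel

namespace Literature.NumberTheory.Rogawski1990

open Literature.NumberTheory.Automorphic Literature.NumberTheory.Automorphic.UnitaryGroup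
open Literature.NumberTheory.Automorphic.IntegralReduction Literature.NumberTheory.Automorphic.UnitaryLatticeTree Literature.NumberTheory.Automorphic.HermitianLattice
open Literature.NumberTheory.GaloisRepresentations Literature.NumberTheory.NumberFields

variable (L : Type) [Field L] [NumberField L] [IsCMField L] (H' : Matrix (Fin 3) (Fin 3) L)
  {v : HeightOneSpectrum (𝓞 ↥(maximalRealSubfield L))}

set_option synthInstance.maxHeartbeats 200000 in
set_option maxHeartbeats 800000 in
-- the strata sets + the lattice set are large terms (★ `…UnitRow` ∕ ★ GSide budgets)
open scoped Classical in
/-- **(B2b-I) THE CLASS TOTAL IS A PLACE COUNT (2-free).**  For a deep match `δ` of a `G`-regular type-(2) `γ_H` (`χ_{g_w}` without a root in `L_w`) at a non-split place `w ∣ v`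
UNRAMIFIED in `L` (any residue characteristic), and any frame `T ∈ GL₃(𝒪_w)` with `H′_w = ᵗ(σ_wT)·J₀·T`, `J₀ = antidiag(1,1,1)`:
`n₀(δ) + n₁(δ) + n₂(δ) = #{M ⊆ L_w³ : M a J₀-self-dual 𝒪_w-lattice, (T δ_w T⁻¹)·M ⊆ M}` (strata of ★ `classOrbitalIntegral_eq_mul_strata_three_of_deep`; right side = ★ (B2a)'s).
[cite: Rogawski1990, §4.9 p. 54, Prop. 4.9.1 (b) p. 55] [cite: Kottwitz1986BaseChangeUnits, §3] [cite: Flicker1998UnitaryFL, §3 Prop. 5 p. 82] -/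
theorem sum_ncard_rankStrata_eq_ncard_isSelfDualLattice_stable_of_frame
    (hH' : (H'.map (IsCMField.complexConj L))ᵀ = H') (w : PlacesOver L v)
    (hw : IsCMField.complexConj L • w.1 = w.1) (hv : Algebra.IsUnramifiedIn (𝓞 L) v.asIdeal) (hH'u : IsUnit H')
    {γH : (cmDatum L 2 (Matrix.of fun i j : Fin 2 => if i.val + j.val + 1 = 2 then (1 : L) else 0)).Local v ×
      (cmDatum L 1 (Matrix.of fun i j : Fin 1 => if i.val + j.val + 1 = 1 then (1 : L) else 0)).Local v}
    (hreg : IsLocalGRegular L v γH)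
    (hirr : ¬ ∃ x : w.1.adicCompletion L, (((γH.1.val : GL (Fin 2) (LocalRing L v)).val.map
        (Pi.evalRingHom (fun w' : PlacesOver L v => w'.1.adicCompletion L) w)).charpoly).IsRoot x)
    (δ : (cmDatum L 3 H').Local v) (h : IsLocalNormPair L H' v γH δ)
    (ht : ∀ m : ℕ, ValuativeRel.valuation (w.1.adicCompletion L)
      (((((δ.val : GL (Fin 3) (LocalRing L v)).val.map (Pi.evalRingHom (fun w' : UnitaryGroup.PlacesOver L v => w'.1.adicCompletion L) w))).charpoly -
        (Polynomial.X - 1) ^ 3).coeff m) < 1)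
    (T : GL (Fin 3) (w.1.adicCompletion L)) (hTint : T ∈ glInt 3 (w.1.adicCompletion L))
    (hJT : placeForm H' w.1 = formCongr (galAdicCompletionMap (L := L) (IsCMField.complexConj L) hw) T ((StdForm.antidiagonal 3).over (w.1.adicCompletion L)))
    {ϖ : w.1.adicCompletion L} (hϖ : Valued.v ϖ = WithZero.exp (-1 : ℤ)) :
    {q : (cmDatum L 3 H').Local v ⧸ cmLocalIntegralLevel L 3 H' v |
            q ∈ MulAction.fixedBy ((cmDatum L 3 H').Local v ⧸ cmLocalIntegralLevel L 3 H' v) δ ∧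
              (redMat ((((q.out⁻¹ * δ * q.out : (cmDatum L 3 H').Local v)).val : GL (Fin 3) (LocalRing L v)).val.map
                (Pi.evalRingHom (fun w' : UnitaryGroup.PlacesOver L v => w'.1.adicCompletion L) w)) - 1).rank = 0}.ncard +
        {q : (cmDatum L 3 H').Local v ⧸ cmLocalIntegralLevel L 3 H' v |
            q ∈ MulAction.fixedBy ((cmDatum L 3 H').Local v ⧸ cmLocalIntegralLevel L 3 H' v) δ ∧
              (redMat ((((q.out⁻¹ * δ * q.out : (cmDatum L 3 H').Local v)).val : GL (Fin 3) (LocalRing L v)).val.map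
                (Pi.evalRingHom (fun w' : UnitaryGroup.PlacesOver L v => w'.1.adicCompletion L) w)) - 1).rank = 1}.ncard +
        {q : (cmDatum L 3 H').Local v ⧸ cmLocalIntegralLevel L 3 H' v |
            q ∈ MulAction.fixedBy ((cmDatum L 3 H').Local v ⧸ cmLocalIntegralLevel L 3 H' v) δ ∧
              (redMat ((((q.out⁻¹ * δ * q.out : (cmDatum L 3 H').Local v)).val : GL (Fin 3) (LocalRing L v)).val.map
                (Pi.evalRingHom (fun w' : UnitaryGroup.PlacesOver L v => w'.1.adicCompletion L) w)) - 1).rank = 2}.ncard =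
      {M : Submodule (Valued.integer (w.1.adicCompletion L)) (Fin 3 → w.1.adicCompletion L) |
        IsSelfDualLattice (galAdicCompletionMap (L := L) (IsCMField.complexConj L) hw) ϖ ((StdForm.antidiagonal 3).over (w.1.adicCompletion L)) M ∧
          M.map ((Matrix.toLin' ((T : Matrix (Fin 3) (Fin 3) (w.1.adicCompletion L)) *
            ((δ.val : GL (Fin 3) (LocalRing L v)) : Matrix (Fin 3) (Fin 3) (LocalRing L v)).map
              (Pi.evalRingHom (fun w' : UnitaryGroup.PlacesOver L v => w'.1.adicCompletion L) w) *
            ((T⁻¹ : GL (Fin 3) (w.1.adicCompletion L)) : Matrix (Fin 3) (Fin 3) (w.1.adicCompletion L)))).restrictScalars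
              (Valued.integer (w.1.adicCompletion L))) ≤ M}.ncard := by
  classical
  have hc1 : IsCMField.complexConj L ≠ 1 := IsCMField.complexConj_ne_one L
  haveI : Algebra.IsQuadraticExtension ↥(maximalRealSubfield L) L := IsCMField.isQuadraticExtension L
  haveI : IsAdicComplete (IsLocalRing.maximalIdeal (Valued.integer (w.1.adicCompletion L))) (Valued.integer (w.1.adicCompletion L)) :=
    isAdicComplete_maximalIdeal_valuedInteger_adicCompletion L w.1
  set σ : w.1.adicCompletion L →+* w.1.adicCompletion L := galAdicCompletionMap (L := L) (IsCMField.complexConj L) hw with hσdef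
  -- (1) Borel σ-algebras and a normalised Haar measure with a canonical family (the statement is measure-free)
  letI : MeasurableSpace ((cmDatum L 3 H').Local v) := borel _
  haveI : BorelSpace ((cmDatum L 3 H').Local v) := ⟨rfl⟩
  letI : ∀ γ : ((cmDatum L 3 H').Local v), MeasurableSpace (((cmDatum L 3 H').Local v) ⧸ Subgroup.centralizer ({γ} : Set ((cmDatum L 3 H').Local v))) :=
    fun _ => borel _
  haveI : ∀ γ : ((cmDatum L 3 H').Local v), BorelSpace (((cmDatum L 3 H').Local v) ⧸ Subgroup.centralizer ({γ} : Set ((cmDatum L 3 H').Local v))) :=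
    fun _ => ⟨rfl⟩
  obtain ⟨νG, _hHaar, _hright, hνG, mG, hmG⟩ := exists_haar_normalised_isCanonical L H' (v := v) hH' hH'u
  -- hermitian data in the `cmConjRingHom` spelling, regularity, compact centraliser (2-free, ★ `…_nonsplit`)
  have hH'c : (H'.map (cmConjRingHom L))ᵀ = H' := by
    have e1 : H'.map (cmConjRingHom L) = H'.map (IsCMField.complexConj L) := by
      ext i j; simp [Matrix.map_apply, cmConjRingHom_apply]
    rw [e1]; exact hH'
  have hdet : H'.det ≠ 0 := (Matrix.isUnit_iff_isUnit_det _ |>.1 hH'u).ne_zero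
  have hreg' : IsRegularElt (δ.val : GL (Fin 3) (LocalRing L v)) := isRegularElt_of_isLocalNormPair L H' v h hreg
  haveI : CompactSpace (Subgroup.centralizer ({δ} : Set ((cmDatum L 3 H').Local v))) :=
    compactSpace_centralizer_of_isLocalNormPair_of_not_exists_isRoot_nonsplit L v w hw hH'u hreg hirr δ h
  -- (2) the strata formula for the constant piece `1_K`, `c ≡ 1`
  have hstr := classOrbitalIntegral_eq_mul_strata_three_of_deep L v w hw νG hH'c hdet hmG δ hreg' ht
    ((cmLocalIntegralLevel L 3 H' v : Set ((cmDatum L 3 H').Local v)).indicator fun _ => (1 : ℂ))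
    (isLocSmooth_indicator_cmLocalIntegralLevel L 3 H' v) (tsupport_indicator_cmLocalIntegralLevel_subset L H')
    (fun u hu x => indicator_cmLocalIntegralLevel_conj L H' u hu x) (fun _ => (1 : ℂ))
    (fun k hk _ => by rw [Set.indicator_of_mem (show (k : (cmDatum L 3 H').Local v) ∈ (cmLocalIntegralLevel L 3 H' v : Set _) from hk)])
  have hν1 : (νG.real (cmLocalIntegralLevel L 3 H' v : Set ((cmDatum L 3 H').Local v)) : ℂ) = 1 := by
    rw [measureReal_def, hνG, ENNReal.toReal_one, Complex.ofReal_one]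
  -- (3) ★ (α): the frame `e g = T g_w T⁻¹` and the transport of the fixed cosets
  have hF : formCongr σ T (placeForm (Matrix.of fun i j : Fin 3 => if i.val + j.val + 1 = 3 then (1 : L) else 0) w.1) =
      (1 : w.1.adicCompletion L) • placeForm H' w.1 := by
    rw [one_smul, placeForm_antidiagOne, ← hJT]
  set e := (localNonsplitCongr (IsCMField.complexConj L) hc1 w hw T isUnit_one hF).trans
    (localNonsplitEquiv (IsCMField.complexConj L) (Matrix.of fun i j : Fin 3 => if i.val + j.val + 1 = 3 then (1 : L) else 0) hc1 w hw) with he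
  have hform : ∀ g, ((e g).val : GL (Fin 3) (w.1.adicCompletion L)) =
      T * ((localNonsplitEquiv (IsCMField.complexConj L) H' hc1 w hw g).val : GL (Fin 3) (w.1.adicCompletion L)) * T⁻¹ :=
    fun g => (congrArg (fun x : ↥(unitaryGroupOfForm (galAdicCompletionMap (L := L) (IsCMField.complexConj L) hw)
        (placeForm (Matrix.of fun i j : Fin 3 => if i.val + j.val + 1 = 3 then (1 : L) else 0) w.1)) => (x.val : GL (Fin 3) (w.1.adicCompletion L)))
          (ContinuousMulEquiv.trans_apply _ _ g)).trans
      (localNonsplitEquiv_localNonsplitCongr (IsCMField.complexConj L) hc1 w hw T isUnit_one hF g)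
  have hlev : ∀ g, g ∈ cmLocalIntegralLevel L 3 H' v ↔ ((e g).val : GL (Fin 3) (w.1.adicCompletion L)) ∈ glInt 3 (w.1.adicCompletion L) :=
    fun g => (hform g).symm ▸ mem_cmLocalIntegralLevel_iff_conj_mem_glInt L H' w hw hTint g
  have hval : classOrbitalIntegral mG ((cmLocalIntegralLevel L 3 H' v : Set ((cmDatum L 3 H').Local v)).indicator fun _ => (1 : ℂ)) (ConjClasses.mk δ) =
      (Nat.card {q : ↥(unitaryGroupOfForm (galAdicCompletionMap (L := L) (IsCMField.complexConj L) hw)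
          (placeForm (Matrix.of fun i j : Fin 3 => if i.val + j.val + 1 = 3 then (1 : L) else 0) w.1)) ⧸
        unitaryInt (galAdicCompletionMap (L := L) (IsCMField.complexConj L) hw)
          (placeForm (Matrix.of fun i j : Fin 3 => if i.val + j.val + 1 = 3 then (1 : L) else 0) w.1) | e δ • q = q} : ℂ) := by
    rw [classOrbitalIntegral_indicator_complex_cmLocalIntegralLevel_eq_natCard_fixedBy L 3 H' v νG hH'c hdet hmG hνG δ hreg',
      natCard_fixedBy_cmLocalIntegralLevel_eq_of_frame L H' w hw e hlev δ]
  -- the total in `ℕ`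
  rw [hval, hν1, one_mul, one_mul, one_mul, one_mul] at hstr
  have htot : Nat.card {q : ↥(unitaryGroupOfForm (galAdicCompletionMap (L := L) (IsCMField.complexConj L) hw)
          (placeForm (Matrix.of fun i j : Fin 3 => if i.val + j.val + 1 = 3 then (1 : L) else 0) w.1)) ⧸
        unitaryInt (galAdicCompletionMap (L := L) (IsCMField.complexConj L) hw)
          (placeForm (Matrix.of fun i j : Fin 3 => if i.val + j.val + 1 = 3 then (1 : L) else 0) w.1) | e δ • q = q} =
      {q : (cmDatum L 3 H').Local v ⧸ cmLocalIntegralLevel L 3 H' v |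
            q ∈ MulAction.fixedBy ((cmDatum L 3 H').Local v ⧸ cmLocalIntegralLevel L 3 H' v) δ ∧
              (redMat ((((q.out⁻¹ * δ * q.out : (cmDatum L 3 H').Local v)).val : GL (Fin 3) (LocalRing L v)).val.map
                (Pi.evalRingHom (fun w' : UnitaryGroup.PlacesOver L v => w'.1.adicCompletion L) w)) - 1).rank = 0}.ncard +
        {q : (cmDatum L 3 H').Local v ⧸ cmLocalIntegralLevel L 3 H' v |
            q ∈ MulAction.fixedBy ((cmDatum L 3 H').Local v ⧸ cmLocalIntegralLevel L 3 H' v) δ ∧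
              (redMat ((((q.out⁻¹ * δ * q.out : (cmDatum L 3 H').Local v)).val : GL (Fin 3) (LocalRing L v)).val.map
                (Pi.evalRingHom (fun w' : UnitaryGroup.PlacesOver L v => w'.1.adicCompletion L) w)) - 1).rank = 1}.ncard +
        {q : (cmDatum L 3 H').Local v ⧸ cmLocalIntegralLevel L 3 H' v |
            q ∈ MulAction.fixedBy ((cmDatum L 3 H').Local v ⧸ cmLocalIntegralLevel L 3 H' v) δ ∧
              (redMat ((((q.out⁻¹ * δ * q.out : (cmDatum L 3 H').Local v)).val : GL (Fin 3) (LocalRing L v)).val.map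
                (Pi.evalRingHom (fun w' : UnitaryGroup.PlacesOver L v => w'.1.adicCompletion L) w)) - 1).rank = 2}.ncard := by
    exact_mod_cast hstr
  rw [← htot]
  -- (4) ★ (B2a) at `t := e δ`: its three 2-free inputs at `J₀`
  have hσσ : ∀ x, σ (σ x) = x := galAdicCompletionMap_galAdicCompletionMap_of_smul_eq (IsCMField.complexConj L) w hc1 hw
  have hvσ : ∀ x, Valued.v (σ x) = Valued.v x := fun x => valued_galAdicCompletionMap (L := L) (IsCMField.complexConj L) hw x
  have hJ0 : placeForm (Matrix.of fun i j : Fin 3 => if i.val + j.val + 1 = 3 then (1 : L) else 0) w.1 =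
      (StdForm.antidiagonal 3).over (w.1.adicCompletion L) := by rw [placeForm_antidiagOne]
  have hJ0det : (placeForm (Matrix.of fun i j : Fin 3 => if i.val + j.val + 1 = 3 then (1 : L) else 0) w.1).det ≠ 0 := by
    rw [hJ0]; exact ((Matrix.isUnit_iff_isUnit_det _).1 ((StdForm.antidiagonal 3).isUnit_over _)).ne_zero
  have hL₀ : IsSelfDualLattice σ ϖ (placeForm (Matrix.of fun i j : Fin 3 => if i.val + j.val + 1 = 3 then (1 : L) else 0) w.1)
      (stdLattice (w.1.adicCompletion L) 3) := by
    rw [hJ0]; exact isSelfDualLattice_stdLattice_three_of_v hϖ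
  -- the trace element `t + σt = 1`, `|t| ≤ 1` (every unramified non-split place)
  have htrace : ∃ t : w.1.adicCompletion L, Valued.v t ≤ 1 ∧ t + σ t = 1 := by
    have hmem : ∀ x ∈ (ValuativeRel.valuation (w.1.adicCompletion L)).integer,
        galAdicCompletionMap (L := L) (IsCMField.complexConj L) hw x ∈ (ValuativeRel.valuation (w.1.adicCompletion L)).integer :=
      fun x hx => galAdicCompletionMap_mem_integer (IsCMField.complexConj L) w hw hx
    let σO := (galAdicCompletionMap (L := L) (IsCMField.complexConj L) hw).restrict _ _ hmem
    obtain ⟨b, hb⟩ := exists_add_map_eq_one_integer (IsCMField.complexConj L) w hc1 hw hv σO (fun _ => rfl) fun x => Subtype.ext (hσσ x)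
    refine ⟨b, ?_, ?_⟩
    · exact (v_le_one_iff_mem_integer (b : w.1.adicCompletion L)).2 b.2
    · exact congrArg Subtype.val hb
  have htrans : ∀ M : Submodule (Valued.integer (w.1.adicCompletion L)) (Fin 3 → w.1.adicCompletion L),
      IsSelfDualLattice σ ϖ (placeForm (Matrix.of fun i j : Fin 3 => if i.val + j.val + 1 = 3 then (1 : L) else 0) w.1) M →
        ∃ u : ↥(unitaryGroupOfForm σ (placeForm (Matrix.of fun i j : Fin 3 => if i.val + j.val + 1 = 3 then (1 : L) else 0) w.1)),
          M = mapGL ((u : ↥(unitaryGroupOfForm σ (placeForm (Matrix.of fun i j : Fin 3 => if i.val + j.val + 1 = 3 then (1 : L) else 0) w.1))) :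
            GL (Fin 3) (w.1.adicCompletion L)) (stdLattice (w.1.adicCompletion L) 3) := by
    rw [hJ0]
    intro M hM
    obtain ⟨u, hu⟩ := exists_unitary_mapGL_stdLattice_eq_of_isSelfDualLattice_of_trace hσσ hvσ hϖ htrace hM
    exact ⟨u, hu.symm⟩
  -- `χ_{eδ} = χ_{δ_w}` is integral (`δ` deep)
  have hmat : (((e δ).val : GL (Fin 3) (w.1.adicCompletion L)) : Matrix (Fin 3) (Fin 3) (w.1.adicCompletion L)) =
      (T : Matrix (Fin 3) (Fin 3) (w.1.adicCompletion L)) *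
        ((δ.val : GL (Fin 3) (UnitaryGroup.LocalRing L v)) : Matrix (Fin 3) (Fin 3) (UnitaryGroup.LocalRing L v)).map
          (Pi.evalRingHom (fun w' : UnitaryGroup.PlacesOver L v => w'.1.adicCompletion L) w) *
        ((T⁻¹ : GL (Fin 3) (w.1.adicCompletion L)) : Matrix (Fin 3) (Fin 3) (w.1.adicCompletion L)) := by
    rw [hform δ, Units.val_mul, Units.val_mul]
    rfl
  have hint : ∀ i, (((e δ : ↥(unitaryGroupOfForm σ (placeForm (Matrix.of fun i j : Fin 3 => if i.val + j.val + 1 = 3 then (1 : L) else 0) w.1))) :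
      GL (Fin 3) (w.1.adicCompletion L)) : Matrix (Fin 3) (Fin 3) (w.1.adicCompletion L)).charpoly.coeff i ∈ Valued.integer (w.1.adicCompletion L) := by
    intro i
    rw [hmat, Matrix.coe_units_inv, Matrix.charpoly_units_conj, valuedInteger_eq_integer]
    have hcoe : (((localNonsplitEquiv (IsCMField.complexConj L) H' hc1 w hw δ :
        ↥(unitaryGroupOfForm (galAdicCompletionMap (L := L) (IsCMField.complexConj L) hw) (placeForm H' w.1))) :
          GL (Fin 3) (w.1.adicCompletion L)) : Matrix (Fin 3) (Fin 3) (w.1.adicCompletion L)) =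
        ((δ.val : GL (Fin 3) (LocalRing L v)) : Matrix (Fin 3) (Fin 3) (LocalRing L v)).map
          (Pi.evalRingHom (fun w' : PlacesOver L v => w'.1.adicCompletion L) w) := rfl
    rw [← hcoe]
    exact charpoly_coeff_mem_integer_of_deep
      ((localNonsplitEquiv (IsCMField.complexConj L) H' hc1 w hw δ :
        ↥(unitaryGroupOfForm (galAdicCompletionMap (L := L) (IsCMField.complexConj L) hw) (placeForm H' w.1))) :
          GL (Fin 3) (w.1.adicCompletion L)) ht i
  -- ★ (B2a)
  rw [natCard_fixedCosets_unitaryInt_eq_ncard_isSelfDualLattice_stable hvσ ϖ hJ0det hL₀ htrans (e δ) hint, hmat, hJ0]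

end Literature.NumberTheory.Rogawski1990

end
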